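import Summits.KontsevichZagierPeriods.KontsevichZagierPeriods.Theses.HurwitzMicroSectors
import Summits.KontsevichZagierPeriods.KontsevichZagierPeriods.Theorems.HurwitzMicroSectorsNormalFormPrinciplePiBoxTransfer
import Summits.KontsevichZagierPeriods.KontsevichZagierPeriods.Theorems.HurwitzMicroSectorsNormalFormPrincipleVariants2239

/-! TTRL-lite variant V2320 of stmt-KontsevichZagierPeriods-3869

Variant V2320 = `stub_boxRigidity` (BoxRigidity: two box-rational representations — domain the open
unit box, integrand `p/q` over `ℚ` — with equal values are KZ-equivalent) under the move
`fix_nat:m=8; bound_nat:m'≤2` (left dimension frozen to `8`, right dimension `m' ≤ 2`). Verdict of the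
attempt seat: **open** — this file is the exact-strength certificate, not a proof of the variant.
The general fact (`boxRigidityFixBound_iff_boxVanishing`, `boxRigidityFixBound_iff_boxVanishing_snd`):
freezing one dimension to `K` and bounding the other by `b` yields exactly BoxVanishing in dimension
`max K b` (every box-rational representation on that box of value `0` is a relation) — forward by
comparison with the zero representation on the `0`-box (resp. the `K`-box), backward by padding to the
common box and subtracting (`boxRigidityLe_of_boxVanishing`, file `…Variants2239`). So V2320 is
**BoxVanishing(`8`)** (`stub_boxRigidity_var2320_iff_boxVanishing_eight`), equivalently BoxRigidity
under the joint bound `m, m' ≤ 8` (`stub_boxRigidity_var2320_iff_le_eight`): Conjecture 1 of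
Kontsevich–Zagier for ALL pairs of rational integrands on the boxes `(0,1)^{≤ 8}` — among these periods
`π⁸`, `ζ(5)`, `ζ(7)`, `ζ(3)ζ(5)`, `ζ(3,5)` and every multiple zeta value of weight `≤ 8` — and it
implies every landed sibling certificate (BoxVanishing `≤ 6`; e.g. V2239/V2349 = BoxVanishing(`3`),
`stub_boxRigidity_var2239_of_var2320`, whose content includes the open `ζ(3) ∉ ℚ + ℚπ²` and the
irrationality of Catalan's constant). Upward `KontsevichZagierPeriods ⇒ parent ⇒ V2320`
(`stub_boxRigidity_var2320_of_statement`), so a refutation would refute the Summit; no invariant of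
`KZ.relations` beyond `eval` is known. The proved two-sided instance is `m, m' ≤ 1` (Baker).
Source: M. Kontsevich, D. Zagier, *Periods* (2001), §1.2 Conjecture 1. Pure proof file, no definitions. -/

-- `Summit.<Summit>.<Problem>` is the tree's mandated summit-side namespace (CONVENTIONS §2); for this
-- single-conjunct summit the two coincide, so the duplicate is deliberate.
set_option linter.dupNamespace false

noncomputable section

namespace Summit.KontsevichZagierPeriods.KontsevichZagierPeriods.Theorems

open MeasureTheory Set
open Literature.NumberTheory.Transcendental Literature.NumberTheory.Transcendental.KZ
open Summit.KontsevichZagierPeriods.KontsevichZagierPeriods.Theses.HurwitzMicroSectors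
open Summit.KontsevichZagierPeriods.HurwitzMicroSectors.NormalFormPrinciple.PiBox

/-! ## Left dimension frozen, right dimension bounded -/

/-- **Left dimension frozen to `K`, right bounded by `b ≤ K` ⟺ BoxVanishing(`K`).** Forward: compare a
box-rational representation on `(0,1)ᴷ` of value `0` with the zero representation on the `0`-box
(`m' = 0 ≤ b`; box-rational, value `0`, itself a relation); backward: pad to `(0,1)ᴷ` and subtract
(`boxRigidityLe_of_boxVanishing`). So every programmatic move `fix_nat:m=K; bound_nat:m'≤b` (`b ≤ K`)
of `stub_boxRigidity` yields exactly BoxVanishing(`K`). [cite: KontsevichZagier2001, §1.2 Conjecture 1] -/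
theorem boxRigidityFixBound_iff_boxVanishing {K b : ℕ} (hb : b ≤ K) :
    (∀ (m' : ℕ) (N : IntegralRep K) (N' : IntegralRep m'), m' ≤ b →
      N.domain = {x | ∀ i, x i ∈ Set.Ioo (0:ℝ) 1} → N.IsRational →
      N'.domain = {x | ∀ i, x i ∈ Set.Ioo (0:ℝ) 1} → N'.IsRational →
      N.value = N'.value → Equivalent N N') ↔
    (∀ (N : IntegralRep K), N.domain = {x | ∀ i, x i ∈ Set.Ioo (0:ℝ) 1} → N.IsRational →
      N.value = 0 → of N ∈ relations) := by
  refine ⟨fun hrig N hNd hNr hv => ?_, fun hvan m' N N' hm' =>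
    boxRigidityLe_of_boxVanishing (j := K) (k := b) le_rfl hb hvan K m' N N' hm' le_rfl⟩
  obtain ⟨Z, hZd, hZi⟩ := exists_zeroRep (isSemialgebraic_box 0)
  have hZ : of Z ∈ relations := of_mem_relations_of_eqOn_zero Z (by simp [hZi, EqOn])
  have hZv : Z.value = 0 := by simp [IntegralRep.value, hZi]
  have hZr : Z.IsRational := ⟨0, 1, fun x _ => by simp, fun x _ => by simp [hZi]⟩
  have h : of N - of Z ∈ relations := hrig 0 N Z (Nat.zero_le b) hNd hNr hZd hZr (by rw [hv, hZv])
  have := relations.add_mem h hZ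
  rwa [sub_add_cancel] at this

/-- **Left dimension frozen to `K ≤ b`, right bounded by `b` ⟺ BoxVanishing(`b`)** (the other case:
the move always yields BoxVanishing in dimension `max K b`). Forward: compare the zero representation
on `(0,1)ᴷ` with a box-rational representation on `(0,1)ᵇ` of value `0`; backward: pad and subtract.
[cite: KontsevichZagier2001, §1.2 Conjecture 1] -/
theorem boxRigidityFixBound_iff_boxVanishing_snd {K b : ℕ} (hK : K ≤ b) :
    (∀ (m' : ℕ) (N : IntegralRep K) (N' : IntegralRep m'), m' ≤ b →
      N.domain = {x | ∀ i, x i ∈ Set.Ioo (0:ℝ) 1} → N.IsRational →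
      N'.domain = {x | ∀ i, x i ∈ Set.Ioo (0:ℝ) 1} → N'.IsRational →
      N.value = N'.value → Equivalent N N') ↔
    (∀ (N : IntegralRep b), N.domain = {x | ∀ i, x i ∈ Set.Ioo (0:ℝ) 1} → N.IsRational →
      N.value = 0 → of N ∈ relations) := by
  refine ⟨fun hrig N hNd hNr hv => ?_, fun hvan m' N N' hm' =>
    boxRigidityLe_of_boxVanishing (j := K) (k := b) hK le_rfl hvan K m' N N' hm' le_rfl⟩
  obtain ⟨Z, hZd, hZi⟩ := exists_zeroRep (isSemialgebraic_box K)
  have hZ : of Z ∈ relations := of_mem_relations_of_eqOn_zero Z (by simp [hZi, EqOn])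
  have hZv : Z.value = 0 := by simp [IntegralRep.value, hZi]
  have hZr : Z.IsRational := ⟨0, 1, fun x _ => by simp, fun x _ => by simp [hZi]⟩
  have h : of Z - of N ∈ relations := hrig b Z N le_rfl hZd hZr hNd hNr (by rw [hv, hZv])
  have := relations.sub_mem hZ h
  rwa [sub_sub_cancel] at this

/-! ## The variant V2320 itself: Conjecture 1 for box-rational periods of dimension 8 -/

/-- **V2320 ⟺ BoxVanishing in dimension `8`** (every box-rational representation on `(0,1)⁸` of
value `0` is a KZ relation; instance `K = 8`, `b = 2`). [cite: KontsevichZagier2001, §1.2 Conjecture 1] -/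
theorem stub_boxRigidity_var2320_iff_boxVanishing_eight :
    (∀ (m' : ℕ) (N : IntegralRep 8) (N' : IntegralRep m'), m' ≤ 2 → N.domain = {x | ∀ i, x i ∈ Set.Ioo (0:ℝ) 1} → N.IsRational → N'.domain = {x | ∀ i, x i ∈ Set.Ioo (0:ℝ) 1} → N'.IsRational → N.value = N'.value → Equivalent N N') ↔
    (∀ (N : IntegralRep 8), N.domain = {x | ∀ i, x i ∈ Set.Ioo (0:ℝ) 1} → N.IsRational →
      N.value = 0 → of N ∈ relations) :=
  boxRigidityFixBound_iff_boxVanishing (by norm_num)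

/-- **V2320 ⟺ BoxRigidity under the joint bound `m, m' ≤ 8`** (the honest strength of the variant:
Conjecture 1 for all pairs of rational integrands on the open unit boxes of dimension at most `8`;
freezing `m := 8` and cutting `m'` down to `2` loses nothing). [cite: KontsevichZagier2001, §1.2 Conjecture 1] -/
theorem stub_boxRigidity_var2320_iff_le_eight :
    (∀ (m' : ℕ) (N : IntegralRep 8) (N' : IntegralRep m'), m' ≤ 2 → N.domain = {x | ∀ i, x i ∈ Set.Ioo (0:ℝ) 1} → N.IsRational → N'.domain = {x | ∀ i, x i ∈ Set.Ioo (0:ℝ) 1} → N'.IsRational → N.value = N'.value → Equivalent N N') ↔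
    (∀ (m m' : ℕ) (N : IntegralRep m) (N' : IntegralRep m'), m' ≤ 8 → m ≤ 8 →
      N.domain = {x | ∀ i, x i ∈ Set.Ioo (0:ℝ) 1} → N.IsRational →
      N'.domain = {x | ∀ i, x i ∈ Set.Ioo (0:ℝ) 1} → N'.IsRational →
      N.value = N'.value → Equivalent N N') :=
  ⟨fun h => boxRigidityLe_of_boxVanishing (j := 8) (k := 8) le_rfl le_rfl
      (stub_boxRigidity_var2320_iff_boxVanishing_eight.1 h),
    fun h m' N N' hm' => h 8 m' N N' (hm'.trans (by norm_num)) le_rfl⟩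

/-- **V2320 ⇒ BoxVanishing in every dimension `≤ 8`** (monotonicity along padding).
[cite: KontsevichZagier2001, §1.2 Conjecture 1] -/
theorem boxVanishing_le_eight_of_stub_boxRigidity_var2320
    (h : ∀ (m' : ℕ) (N : IntegralRep 8) (N' : IntegralRep m'), m' ≤ 2 → N.domain = {x | ∀ i, x i ∈ Set.Ioo (0:ℝ) 1} → N.IsRational → N'.domain = {x | ∀ i, x i ∈ Set.Ioo (0:ℝ) 1} → N'.IsRational → N.value = N'.value → Equivalent N N')
    {m : ℕ} (hm : m ≤ 8) (N : IntegralRep m) (hNd : N.domain = {x | ∀ i, x i ∈ Set.Ioo (0:ℝ) 1})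
    (hNr : N.IsRational) (hv : N.value = 0) : of N ∈ relations :=
  boxVanishing_mono hm (stub_boxRigidity_var2320_iff_boxVanishing_eight.1 h) N hNd hNr hv

/-- **V2320 ⇒ the sibling V2239** (`bound_nat:m≤3; bound_nat:m'≤2` = BoxVanishing(`3`), open: it
contains the pairs `[1/(1−xyz)]` versus `[a + b/(1−xy)]`, case split `ζ(3) ∈ ℚ + ℚπ²`, and the
level-`4` weight-`2` sector without `Indep_ℚ(1, π², G)`). [cite: KontsevichZagier2001, §1.2 Conjecture 1] -/
theorem stub_boxRigidity_var2239_of_var2320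
    (h : ∀ (m' : ℕ) (N : IntegralRep 8) (N' : IntegralRep m'), m' ≤ 2 → N.domain = {x | ∀ i, x i ∈ Set.Ioo (0:ℝ) 1} → N.IsRational → N'.domain = {x | ∀ i, x i ∈ Set.Ioo (0:ℝ) 1} → N'.IsRational → N.value = N'.value → Equivalent N N') :
    ∀ (m m' : ℕ) (N : IntegralRep m) (N' : IntegralRep m'), m' ≤ 2 → m ≤ 3 → N.domain = {x | ∀ i, x i ∈ Set.Ioo (0:ℝ) 1} → N.IsRational → N'.domain = {x | ∀ i, x i ∈ Set.Ioo (0:ℝ) 1} → N'.IsRational → N.value = N'.value → Equivalent N N' :=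
  stub_boxRigidity_var2239_iff_boxVanishing_three.2
    (fun N hNd hNr hv => boxVanishing_le_eight_of_stub_boxRigidity_var2320 h (by norm_num) N hNd hNr hv)

/-- **parent ⇒ V2320** (the variant is a specialisation of `stub_boxRigidity`).
[cite: KontsevichZagier2001, §1.2 Conjecture 1] -/
theorem stub_boxRigidity_var2320_of_parent
    (h : ∀ (m m' : ℕ) (N : IntegralRep m) (N' : IntegralRep m'), N.domain = {x | ∀ i, x i ∈ Set.Ioo (0:ℝ) 1} → N.IsRational → N'.domain = {x | ∀ i, x i ∈ Set.Ioo (0:ℝ) 1} → N'.IsRational → N.value = N'.value → Equivalent N N') :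
    ∀ (m' : ℕ) (N : IntegralRep 8) (N' : IntegralRep m'), m' ≤ 2 → N.domain = {x | ∀ i, x i ∈ Set.Ioo (0:ℝ) 1} → N.IsRational → N'.domain = {x | ∀ i, x i ∈ Set.Ioo (0:ℝ) 1} → N'.IsRational → N.value = N'.value → Equivalent N N' :=
  fun m' N N' _ => h 8 m' N N'

/-- **`KontsevichZagierPeriods ⇒ V2320`**: the variant is a special case of Conjecture 1 for the
tree's calculus — a refutation of the variant would refute the Summit.
[cite: KontsevichZagier2001, §1.2 Conjecture 1] -/
theorem stub_boxRigidity_var2320_of_statement (h : _root_.KontsevichZagierPeriods) :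
    ∀ (m' : ℕ) (N : IntegralRep 8) (N' : IntegralRep m'), m' ≤ 2 → N.domain = {x | ∀ i, x i ∈ Set.Ioo (0:ℝ) 1} → N.IsRational → N'.domain = {x | ∀ i, x i ∈ Set.Ioo (0:ℝ) 1} → N'.IsRational → N.value = N'.value → Equivalent N N' :=
  stub_boxRigidity_var2320_of_parent (leaves_of_statement h).1

end Summit.KontsevichZagierPeriods.KontsevichZagierPeriods.Theorems
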